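import Mathlib
import Summits.AtomisticToContinuum.HydrodynamicLimit.Theorems.ImplosionDichotomyDenseExcursionCavityResFuchsUniform

/-!
# Lipschitz dependence of the smooth branch (`Re ν ≤ −1`, vector-valued regular row) on the coefficients
# (crux `DenseExcursion`, line `sonic-cavity-renewal`, brick for stub `stub_cavityResolventCk`, theorem T7(i) (γ))

Helper file (`--supports stmt-AtomisticToContinuum-12586`, line lead a2, stub-worker E2 for `stub_cavityResolventCk`).
Registered helper `res_fuchs_lipschitz` — THE DIFFERENCE TRICK at the level of the first-kind singular system with a
vector-valued regular row: for bounds `A₁, A, B, D` there are `0 < δ ≤ 1` and `K` such that for TWO coefficient systems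
`a, a′` within the bounds (exponents `Re a₁₁(0), Re a₁₁′(0) ≤ −1`), the same smooth sources and two `C^∞` solutions
`(u, c)` of `a`, `(u′, c′)` of `a′` on `(−δ′, δ′)`, `δ′ ≤ δ`, with the same datum `c(0) = c′(0)`:

  `‖u − u′‖, ‖c − c′‖ ≤ K · L · (‖c(0)‖ + N)`   on `[−R₁, R₁]`, `R₁ < δ′`,

whenever the sources are bounded by `N` and the coefficient differences `‖aᵢⱼ − aᵢⱼ′‖` by `L` on `[−R₁, R₁]`. Proof: the
difference solves the primed system with the source `(a − a′)·(u, c)` (cut off to a global smooth source outside a slightly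
larger interval) and zero datum; two applications of the a priori bound of `res_fuchs_uniform`. With coefficients depending
on `Λ` in a Lipschitz way (the sonic coefficients are affine in `Λ`, the derived ones polynomial) this is the continuity in
`Λ` of the local branches that the uniform matching of T7(i) needs, valid up to and across the jet resonances once the
resonance has been removed by differentiation. Sources: folklore.
-/

noncomputable section

open Set Filter
open scoped Topology ContDiff

namespace Summit.AtomisticToContinuum.HydrodynamicLimit.Theorems.SonicCavityRenewal

/-- **Registered helper `res_fuchs_lipschitz`: LIPSCHITZ DEPENDENCE OF THE SMOOTH BRANCH ON THE COEFFICIENTS.** See the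
module docstring. [folklore] -/
theorem res_fuchs_lipschitz : ∀ (E : Type) [NormedAddCommGroup E] [NormedSpace ℂ E] [CompleteSpace E] (A₁ A B D : ℝ), 0 ≤ A₁ → 0 ≤ A → 0 ≤ B → 0 ≤ D → ∃ δ : ℝ, 0 < δ ∧ δ ≤ 1 ∧ ∃ K : ℝ, 0 ≤ K ∧ ∀ (ν ν' : ℂ) (a₁₁ a₁₁' : ℝ → ℂ) (a₁₂ a₁₂' : ℝ → E →L[ℂ] ℂ) (a₂₁ a₂₁' : ℝ → ℂ →L[ℂ] E) (a₂₂ a₂₂' : ℝ → E →L[ℂ] E), ν.re ≤ -1 → ν'.re ≤ -1 → ContDiff ℝ ∞ a₁₁ → ContDiff ℝ ∞ a₁₂ → ContDiff ℝ ∞ a₂₁ → ContDiff ℝ ∞ a₂₂ → ContDiff ℝ ∞ a₁₁' → ContDiff ℝ ∞ a₁₂' → ContDiff ℝ ∞ a₂₁' → ContDiff ℝ ∞ a₂₂' → a₁₁ 0 = ν → a₁₁' 0 = ν' → (∀ s ∈ Set.Icc (-1 : ℝ) 1, ‖deriv a₁₁ s‖ ≤ A₁ ∧ ‖a₁₂ s‖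 ≤ A ∧ ‖a₂₁ s‖ ≤ B ∧ ‖a₂₂ s‖ ≤ D) → (∀ s ∈ Set.Icc (-1 : ℝ) 1, ‖deriv a₁₁' s‖ ≤ A₁ ∧ ‖a₁₂' s‖ ≤ A ∧ ‖a₂₁' s‖ ≤ B ∧ ‖a₂₂' s‖ ≤ D) → ∀ (b₁ : ℝ → ℂ) (b₂ : ℝ → E), ContDiff ℝ ∞ b₁ → ContDiff ℝ ∞ b₂ → ∀ (u u' : ℝ → ℂ) (c c' : ℝ → E) (δ' : ℝ), 0 < δ' → δ' ≤ δ → ContDiffOn ℝ ∞ u (Set.Ioo (-δ') δ') → ContDiffOn ℝ ∞ c (Set.Ioo (-δ') δ') → ContDiffOn ℝ ∞ u' (Set.Ioo (-δ') δ') → ContDiffOn ℝ ∞ c' (Set.Ioo (-δ') δ') → (∀ R ∈ Set.Ioo (-δ') δ', (R : ℂ) * deriv u R = a₁₁ R * u R + a₁₂ R (c R) + b₁ R ∧ deriv c R = a₂₁ R (u R) + a₂₂ R (c R) + b₂ R) → (∀ R ∈ Set.Ioo (-δ') δ', (R : ℂ) * deriv u' R = a₁₁' R * u' R + a₁₂'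 R (c' R) + b₁ R ∧ deriv c' R = a₂₁' R (u' R) + a₂₂' R (c' R) + b₂ R) → c 0 = c' 0 → ∀ (R₁ N L : ℝ), 0 ≤ R₁ → R₁ < δ' → 0 ≤ L → (∀ s ∈ Set.Icc (-R₁) R₁, ‖b₁ s‖ ≤ N ∧ ‖b₂ s‖ ≤ N) → (∀ s ∈ Set.Icc (-R₁) R₁, ‖a₁₁ s - a₁₁' s‖ ≤ L ∧ ‖a₁₂ s - a₁₂' s‖ ≤ L ∧ ‖a₂₁ s - a₂₁' s‖ ≤ L ∧ ‖a₂₂ s - a₂₂' s‖ ≤ L) → ∀ R ∈ Set.Icc (-R₁) R₁, ‖u R - u' R‖ ≤ K * L * (‖c 0‖ + N) ∧ ‖c R - c' R‖ ≤ K * L * (‖c 0‖ + N) := by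
  intro E _ _ _ A₁ A B D hA₁ hA hB hD
  obtain ⟨δ, hδ, hδ1, K₀, hK₀, hmain⟩ := res_fuchs_uniform E A₁ A B D hA₁ hA hB hD
  refine ⟨δ, hδ, hδ1, 2 * K₀ * K₀, by positivity, ?_⟩
  intro ν ν' a₁₁ a₁₁' a₁₂ a₁₂' a₂₁ a₂₁' a₂₂ a₂₂' hν hν' ha₁₁ ha₁₂ ha₂₁ ha₂₂ ha₁₁' ha₁₂' ha₂₁' ha₂₂' h0 h0' hbd hbd' b₁ b₂ hb₁ hb₂
    u u' c c' δ' hδ' hδ'δ hu hc hu' hc' hsol hsol' hc0 R₁ N L hR₁ hR₁δ' hL hN hLb R hR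
  have hO : IsOpen (Ioo (-δ') δ') := isOpen_Ioo
  have hle1 : ((1 : ℕ∞) : WithTop ℕ∞) ≤ ∞ := by exact_mod_cast le_top
  -- the a priori bound for `(u, c)` itself
  obtain ⟨-, hap⟩ := hmain ν a₁₁ a₁₂ a₂₁ a₂₂ hν ha₁₁ ha₁₂ ha₂₁ ha₂₂ h0 hbd b₁ b₂ hb₁ hb₂
  have hbd_uc : ∀ s ∈ Icc (-R₁) R₁, ‖u s‖ ≤ K₀ * (‖c 0‖ + N) ∧ ‖c s‖ ≤ K₀ * (‖c 0‖ + N) :=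
    hap u c δ' hδ' hδ'δ (hu.of_le hle1) (hc.of_le hle1) hsol R₁ N hR₁ hR₁δ' hN
  -- a slightly larger radius `R₁ < r < δ'` and the cut-off source of the difference
  set r : ℝ := (R₁ + δ') / 2 with hr
  have hR₁r : R₁ < r := by rw [hr]; linarith
  have hrδ' : r < δ' := by rw [hr]; linarith
  have hr0 : 0 < r := by rw [hr]; linarith
  set β₁ : ℝ → ℂ := fun s => (a₁₁ s - a₁₁' s) * u s + (a₁₂ s - a₁₂' s) (c s) with hβ₁
  set β₂ : ℝ → E := fun s => (a₂₁ s - a₂₁' s) (u s) + (a₂₂ s - a₂₂' s) (c s) with hβ₂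
  have sβ₁ : ContDiffOn ℝ ∞ β₁ (Ioo (-δ') δ') := by
    rw [hβ₁]
    exact ((ha₁₁.sub ha₁₁').contDiffOn.mul hu).add (contDiffOn_clm_apply_real (ha₁₂.sub ha₁₂').contDiffOn hc)
  have sβ₂ : ContDiffOn ℝ ∞ β₂ (Ioo (-δ') δ') := by
    rw [hβ₂]
    exact (contDiffOn_clm_apply_real (ha₂₁.sub ha₂₁').contDiffOn hu).add
      (contDiffOn_clm_apply_real (ha₂₂.sub ha₂₂').contDiffOn hc)
  obtain ⟨B₁, hB₁, eB₁⟩ := exists_contDiff_eq_on_Icc hr0 hrδ' sβ₁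
  obtain ⟨B₂, hB₂, eB₂⟩ := exists_contDiff_eq_on_Icc hr0 hrδ' sβ₂
  -- the difference solves the primed system with source `(B₁, B₂)` on `(−r, r)`, with zero datum
  have hsub : Ioo (-r) r ⊆ Ioo (-δ') δ' := Ioo_subset_Ioo (by linarith) hrδ'.le
  have hdf : ∀ {φ : ℝ → ℂ}, ContDiffOn ℝ ∞ φ (Ioo (-δ') δ') → ∀ y ∈ Ioo (-δ') δ', HasDerivAt φ (deriv φ y) y :=
    fun hφ y hy => ((hφ.differentiableOn (by simp)) y hy |>.differentiableAt (hO.mem_nhds hy)).hasDerivAt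
  have hdfE : ∀ {φ : ℝ → E}, ContDiffOn ℝ ∞ φ (Ioo (-δ') δ') → ∀ y ∈ Ioo (-δ') δ', HasDerivAt φ (deriv φ y) y :=
    fun hφ y hy => ((hφ.differentiableOn (by simp)) y hy |>.differentiableAt (hO.mem_nhds hy)).hasDerivAt
  have hsold : ∀ s ∈ Ioo (-r) r, (s : ℂ) * deriv (fun y => u y - u' y) s =
      a₁₁' s * (u s - u' s) + a₁₂' s (c s - c' s) + B₁ s ∧
      deriv (fun y => c y - c' y) s = a₂₁' s (u s - u' s) + a₂₂' s (c s - c' s) + B₂ s := by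
    intro s hs
    have hs' := hsub hs
    obtain ⟨e1, e2⟩ := hsol s hs'
    obtain ⟨f1, f2⟩ := hsol' s hs'
    rw [((hdf hu s hs').fun_sub (hdf hu' s hs')).deriv, ((hdfE hc s hs').fun_sub (hdfE hc' s hs')).deriv,
      eB₁ (Ioo_subset_Icc_self hs), eB₂ (Ioo_subset_Icc_self hs)]
    simp only [hβ₁, hβ₂, map_sub, FunLike.coe_sub, Pi.sub_apply]
    constructor
    · linear_combination e1 - f1
    · rw [e2, f2]; abel
  obtain ⟨-, hap'⟩ := hmain ν' a₁₁' a₁₂' a₂₁' a₂₂' hν' ha₁₁' ha₁₂' ha₂₁' ha₂₂' h0' hbd' B₁ B₂ hB₁ hB₂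
  -- the size of the source on `[−R₁, R₁]`
  have hc0N : 0 ≤ ‖c 0‖ + N := by
    have := (hN 0 ⟨by linarith, hR₁⟩).1
    linarith [norm_nonneg (b₁ 0), norm_nonneg (c 0)]
  have hNβ : ∀ s ∈ Icc (-R₁) R₁, ‖B₁ s‖ ≤ 2 * L * K₀ * (‖c 0‖ + N) ∧ ‖B₂ s‖ ≤ 2 * L * K₀ * (‖c 0‖ + N) := by
    intro s hs
    have hsr : s ∈ Icc (-r) r := ⟨by linarith [hs.1], by linarith [hs.2]⟩
    obtain ⟨l1, l2, l3, l4⟩ := hLb s hs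
    obtain ⟨bu, bc⟩ := hbd_uc s hs
    rw [eB₁ hsr, eB₂ hsr]
    simp only [hβ₁, hβ₂]
    have hm : ∀ {F : Type} [NormedAddCommGroup F] [NormedSpace ℂ F] {G : Type} [NormedAddCommGroup G] [NormedSpace ℂ G]
        (T : F →L[ℂ] G) (v : F), ‖T‖ ≤ L → ‖v‖ ≤ K₀ * (‖c 0‖ + N) → ‖T v‖ ≤ L * (K₀ * (‖c 0‖ + N)) :=
      fun T v hT hv => (T.le_opNorm v).trans (mul_le_mul hT hv (norm_nonneg _) hL)
    have e : 2 * L * K₀ * (‖c 0‖ + N) = L * (K₀ * (‖c 0‖ + N)) + L * (K₀ * (‖c 0‖ + N)) := by ring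
    rw [e]
    constructor
    · refine (norm_add_le _ _).trans (add_le_add ?_ (hm _ _ l2 bc))
      rw [norm_mul]; exact mul_le_mul l1 bu (norm_nonneg _) hL
    · exact (norm_add_le _ _).trans (add_le_add (hm _ _ l3 bu) (hm _ _ l4 bc))
  have key := hap' (fun y => u y - u' y) (fun y => c y - c' y) r hr0 (hrδ'.le.trans hδ'δ)
    (((hu.sub hu').mono hsub).of_le hle1) (((hc.sub hc').mono hsub).of_le hle1) hsold R₁ (2 * L * K₀ * (‖c 0‖ + N))
    hR₁ hR₁r hNβ R hR
  simp only [hc0, sub_self, norm_zero, zero_add] at key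
  have e : K₀ * (2 * L * K₀ * (‖c' 0‖ + N)) = 2 * K₀ * K₀ * L * (‖c' 0‖ + N) := by ring
  rw [e] at key
  rw [hc0]
  exact key

end Summit.AtomisticToContinuum.HydrodynamicLimit.Theorems.SonicCavityRenewal

end
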